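import Summits.RiemannHypothesis.RiemannHypothesis.Theses.MayerPairing
import Summits.RiemannHypothesis.RiemannHypothesis.Theorems.MayerPairingEigenvaluePredicate
import Literature.Dynamics.TransferOperators.ChangMayerEigenfunction
import Literature.Dynamics.TransferOperators.MayerTransferCompact
import Literature.Dynamics.TransferOperators.MayerTransferOperatorHolomorphy
import Literature.Analysis.OperatorTheory.RieszProjectionContour

/-!
# Line `weinstein-aronszajn-pinning` — skeleton for crux `MayerPairing.BranchPairing`

Crux item stmt-RiemannHypothesis-1471, decl
`Summit.RiemannHypothesis.RiemannHypothesis.Theses.MayerPairing.BranchPairing`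
(route `route-RiemannHypothesis-MayerPairing`); idea card
`Cruxes/BranchPairing/Ideas/weinstein-aronszajn-pinning.md` (crux-ideate r1, passed by all three
triagers, merged with `frozen-eisenstein-rank-one`, `frozen-eisenstein-pencil`,
`eisenstein-defect-coefficient`, `constant-term-mass-ratio`: ONE lever).

## The lever (proved below, `pinnedTransfer_eisenstein`)

With `c(s) = ζ(2s)/(2ζ(2s−1))` (`pinCoeff`) and the rank-one operator `K g = g(0)·𝟙` (`pinK`), the
PINNED operator `L̃_s := L_s + c(s) K` (`pinnedTransfer`) satisfies `L̃_s f_s = f_s` for EVERY `s` in the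
open strip `0 < Re s < 1/2`, `f_s = ψ(2s, ·+1) ≠ 0` (one line from the in-tree defect identity
`mayerTransfer_zagierPsi_toFun`: `L_s f_s = f_s − ζ(2s)/2·𝟙`, `f_s(0) = ζ(2s−1) ≠ 0`). So the eigenvalue
`1` is frozen along every horizontal segment, and `L_s = L̃_s − c(s)K` is a rank-one perturbation of
size `|c(s)|`, vanishing exactly at the zeros of `ζ(2s)` — in particular at BOTH endpoints
`ρ/2`, `(1−ρ̄)/2` of the BranchPairing segment of a zero `ρ`.

## The line (three stubs + kernel-checked composition `BranchPairing_of`)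

* `stub_weinsteinAronszajn` (M): the Weinstein–Aronszajn / Sherman–Morrison secular equation for the
  rank-one difference: for `μ ∉ spec L̃_s`, `μ ∈ spec L_s ↔ 1 + c(s)·G̃(s,μ) = 0`,
  `G̃(s,μ) = δ₀((μ − L̃_s)⁻¹𝟙)` (`pinnedG`). Pure Banach-algebra.
* `stub_katoSelection` (L, ζ-free, general Banach space): a norm-continuous family of compact
  operators over a real interval whose spectra avoid a continuously moving circle `|μ−1| = δ(σ) < 1`
  admits a CONTINUOUS selection of spectral points inside the tube, once the tube is inhabited at the
  left end (Kato IV-§3.5, held copy PDF pp.260–261, via IV-§3.4 Thm 3.16; II-§5.2 Thm 5.2, PDF p.143; Riesz projections are in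
  `Literature.Analysis.OperatorTheory.RieszProjection*`).
* `stub_pinnedTube` (THE RH-strength stub, hardest): for every OFF-LINE zero `ρ` (`0 < Re ρ < 1/2`,
  `Im ρ > 14`) there is a continuous radius `δ(σ) ∈ (0,1)` along the segment such that the circle
  `|μ − 1| = δ(σ)` lies in the resolvent set of the PINNED operator and carries `‖c(s)·G̃(s,μ)‖ < 1`,
  and at the two endpoints (where `c = 0`, `L̃ = L`) the closed disc meets `spec L̃_s` only in `1`.
  By the secular equation the circle then lies in `res(L_s)` too, so the eigenvalue cluster of `L_s`
  near `1` is CONFINED to the tube: no hopping. Vacuous under RH, RH-strength without it — exactly the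
  part of BranchPairing that is not the dictionary (Disproof.lean §1).
* `BranchPairing_of : WeinsteinAronszajn → KatoSelection → PinnedTube → BranchPairing` (no sorry):
  on-line zeros are the in-tree dictionary (`exists_eigenfunction_of_riemannZeta_eq_zero`, segment =
  one point); for off-line zeros the tube boundary ⊂ `res(L_s)` by W–A; Kato gives a continuous `Λ` in
  the tube, started at the frozen eigenvalue `1 ∈ spec L̃_{ρ/2} = spec L_{ρ/2}` (the lever); endpoint
  isolation forces `Λ = 1` at both ends; `Λ ≠ 0` (`δ < 1`) is an eigenvalue by Mathlib's Fredholm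
  alternative and in-tree compactness; the predicate bridge `mayerPairing_branchPairing_iff_operator`
  (in tree) returns the route's decl. `BranchPairing_proof : BranchPairing` assembles the three stubs.

For the lead: `Lines/` is never imported, so step 0 is to land the seven definitions below (and the
proved lever lemmas) verbatim as a Theorems defs file (convention `MayerPairingPinningDefs.lean`) and
re-point this skeleton at it; the stub statements do not change.

Disproof.lean obligations honoured: `not_withoutZero_of_ucc` / `branchPairing_false_without_zero`
(`ζ ρ = 0` is load-bearing) — used at `stub_pinnedTube`'s endpoint clause and in the glue
(`c(ρ/2) = 0`, `c((1−ρ̄)/2) = 0` via the functional equation); `withoutContinuity_of_dict_of_nonempty`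
(continuity is the content) — continuity comes from `stub_katoSelection` fed by the tube;
`not_eisensteinSheet`, `not_gaussKuzminAnchoring`, `not_verticalPairing`, `not_mirrorSymmetryConjInv`,
`not_modulusPairing` — no global sheet, no anchoring path, no vertical segment, no symmetry and no
unit-circle reading is used: the line works on ONE horizontal segment with the eigenvalue EXACTLY `1`
(i.e. `c = 0`) at both ends. No Negative lemma has landed under `Theorems/BranchPairing/Negative/`
(checked 2026-08-16).
-/

set_option linter.dupNamespace false -- `RiemannHypothesis.RiemannHypothesis` is the mandated Summit/Sub path

noncomputable section

namespace Summit.RiemannHypothesis.RiemannHypothesis.Cruxes.BranchPairing.WeinsteinAronszajnPinning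

open Filter Topology Metric Set Complex
open scoped ComplexConjugate
open Literature.Dynamics.TransferOperators
open Summit.RiemannHypothesis.RiemannHypothesis.Theses.MayerPairing
open Summit.RiemannHypothesis.RiemannHypothesis.Theorems

/-! ## Objects of the line (real definitions over the Literature's `mayerTransfer`, `MayerSpace`) -/

/-- The constant function `𝟙 ∈ B(D)`. -/
def oneB : MayerSpace :=
  MayerSpace.mk (fun _ => (1 : ℂ)) continuousOn_const (differentiableOn_const 1)

/-- Evaluation at `0 ∈ D̄`, `δ₀ : B(D) →L[ℂ] ℂ`. -/
def ev0 : MayerSpace →L[ℂ] ℂ :=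
  MayerSpace.evalCLM ⟨0, zero_mem_mayerClosedDisc⟩

/-- The rank-one pinning operator `K = 𝟙 ⊗ δ₀ : g ↦ g(0)·𝟙`. -/
def pinK : MayerSpace →L[ℂ] MayerSpace :=
  ev0.smulRight oneB

/-- The pinning coefficient `c(s) = ζ(2s) / (2 ζ(2s − 1))` (finite on the open strip, where
`ζ(2s − 1) ≠ 0`; it vanishes there exactly at the zeros of `ζ(2s)`). -/
def pinCoeff (s : ℂ) : ℂ :=
  riemannZeta (2 * s) / (2 * riemannZeta (2 * s - 1))

/-- The PINNED transfer operator `L̃_s = L_s + c(s)·(𝟙 ⊗ δ₀)`. -/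
def pinnedTransfer (s : ℂ) : MayerSpace →L[ℂ] MayerSpace :=
  mayerTransfer s + pinCoeff s • pinK

/-- The pinned resolvent matrix element `G̃(s, μ) = δ₀((μ − L̃_s)⁻¹ 𝟙)`, written with Mathlib's
`resolvent a μ = Ring.inverse (algebraMap ℂ _ μ − a)` (junk value `0` when `μ ∈ spec L̃_s`; every use
below is guarded by `μ ∉ spectrum ℂ (pinnedTransfer s)`). -/
def pinnedG (s μ : ℂ) : ℂ :=
  ev0 (resolvent (pinnedTransfer s) μ oneB)

/-- The parameter `s = σ + i·(Im ρ)/2` on the BranchPairing segment, spelled exactly as in the route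
file. -/
def sPar (σ : ℝ) (ρ : ℂ) : ℂ :=
  (σ : ℂ) + ((ρ.im / 2 : ℝ) : ℂ) * Complex.I

/-! ## The three stub statements -/

/-- STUB 1 (M) — **Weinstein–Aronszajn / Sherman–Morrison secular equation** for the rank-one
difference `L_s = L̃_s − c(s)(𝟙 ⊗ δ₀)`: off the spectrum of the pinned operator,
`μ ∈ spec L_s ↔ 1 + c(s)·δ₀((μ − L̃_s)⁻¹𝟙) = 0`. Pure algebra in the Banach algebra
`B(D) →L[ℂ] B(D)` (`μ − L_s = (μ − L̃_s)(1 + c (μ − L̃_s)⁻¹ K)` and `1 + u ⊗ φ` is a unit iff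
`1 + φ(u) ≠ 0`); no hypothesis on `s` is needed. -/
def WeinsteinAronszajn : Prop :=
  ∀ s μ : ℂ, μ ∉ spectrum ℂ (pinnedTransfer s) →
    (μ ∈ spectrum ℂ (mayerTransfer s) ↔ 1 + pinCoeff s * pinnedG s μ = 0)

/-- STUB 2 (L, ζ-free) — **Kato selection in a resolvent tube.** A norm-continuous family
`σ ↦ T σ` of compact operators on a complex Banach space over `[a, b]`, a continuous radius
`0 < δ(σ) < 1` such that the circle `|μ − 1| = δ(σ)` never meets `spec (T σ)`, and one spectral
point inside the circle at `σ = a`: then there is a CONTINUOUS `Λ` on `[a, b]` with `Λ σ ∈ spec (T σ)`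
and `|Λ σ − 1| < δ σ`. (The Riesz projection over the circle has constant finite rank `m ≥ 1` —
Kato IV-§3.4 Thm 3.16 / IV-§3.5 "continuity of a finite system of eigenvalues", held copy PDF
pp.260–261; `δ < 1` keeps `0` outside — the `m` eigenvalues inside form a continuous unordered
`m`-tuple, and over a real interval such a tuple is covered by `m` continuous functions, Kato II-§5.2
Thm 5.2, PDF p.143: "there exist N single-valued, continuous functions … the values of which
constitute the N-tuple".) -/
def KatoSelection : Prop :=
  ∀ (E : Type) [NormedAddCommGroup E] [NormedSpace ℂ E] [CompleteSpace E]
    (T : ℝ → (E →L[ℂ] E)) (δ : ℝ → ℝ) (a b : ℝ), a ≤ b →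
    ContinuousOn T (Set.Icc a b) → ContinuousOn δ (Set.Icc a b) →
    (∀ σ ∈ Set.Icc a b, IsCompactOperator (T σ)) →
    (∀ σ ∈ Set.Icc a b, 0 < δ σ ∧ δ σ < 1) →
    (∀ σ ∈ Set.Icc a b, ∀ μ : ℂ, ‖μ - 1‖ = δ σ → μ ∉ spectrum ℂ (T σ)) →
    (∃ μ ∈ spectrum ℂ (T a), ‖μ - 1‖ < δ a) →
    ∃ Λ : ℝ → ℂ, ContinuousOn Λ (Set.Icc a b) ∧
      ∀ σ ∈ Set.Icc a b, ‖Λ σ - 1‖ < δ σ ∧ Λ σ ∈ spectrum ℂ (T σ)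

/-- STUB 3 (RH-strength; the hardest) — **the pinned tube.** For every OFF-LINE zero `ρ` of `ζ`
(`0 < Re ρ < 1/2`, `Im ρ > 14`; on-line zeros need no stub, see `BranchPairing_of`), along the
segment `σ ∈ [Re ρ/2, (1 − Re ρ)/2]` at height `Im ρ/2` there is a continuous radius
`δ(σ) ∈ (0, 1)` such that
(i) the circle `|μ − 1| = δ(σ)` lies in the resolvent set of the PINNED operator `L̃_s` and on it
`‖c(s)·G̃(s, μ)‖ < 1` (so, by STUB 1, the circle lies in `res L_s` as well), and
(ii) at the two endpoints (zeros of `c`, where `L̃_s = L_s`) the disc `|μ − 1| < δ` meets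
`spec L̃_s` only in the frozen eigenvalue `1`.
Vacuous under RH and RH-strength without it — exactly the residue of the crux that is not the
dictionary (Disproof.lean §1: BP ↔ RH-quarter modulo dictionary and UCC). This is where `ζ ρ = 0`
and all the arithmetic sit: the size of `c(s) = ζ(2s)/(2ζ(2s−1))` (`≪ γ^{σ−1} log² γ`, convexity)
against the pinned resolvent element `G̃(s,·)` on a gap circle of `L̃_s` (first-order size
`|c r|/δ + |c|·sup|H|` with `G̃ = r/(μ−1) + H`; triage numerics: `|c r|/d ≈ 0.24–0.61`, no decay seen
up to `τ = 20`). The sharper residue form of the idea card (`2|c r| < d`, `|c|·sup|H| < 1/2`, Rouché)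
gives (i) on the circle `|μ − 1| = 2|c(s) r(s)|` wherever `c(s) ≠ 0`, off the Jordan set
`B₀ = {δ₀((1−L_s)⁻²𝟙) = 0}` where the pinned pole is not simple; the tube form needs neither `r ≠ 0`
nor a simple pole as hypotheses and lets `δ` stay bounded below near the endpoints. Where it must
fail (sibling line card `frozen-eisenstein-rank-one`, 2×2 W–A model): on segments crossing a HOPPING
BAND of heights around a point of `B₀`, where the eigenvalue near `1` is exchanged with the partner
sheet — a circle centred at `1` with constant cluster size cannot follow the exchange, and BP itself is
predicted to fail there; so the stub contains the RH-strength repulsion "no off-line zero segment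
crosses a hopping band". -/
def PinnedTube : Prop :=
  ∀ ρ : ℂ, riemannZeta ρ = 0 → 0 < ρ.re → ρ.re < 1 / 2 → 14 < ρ.im →
    ∃ δ : ℝ → ℝ, ContinuousOn δ (Set.Icc (ρ.re / 2) ((1 - ρ.re) / 2)) ∧
      ∀ σ ∈ Set.Icc (ρ.re / 2) ((1 - ρ.re) / 2), 0 < δ σ ∧ δ σ < 1 ∧
        (∀ μ : ℂ, ‖μ - 1‖ = δ σ →
          μ ∉ spectrum ℂ (pinnedTransfer (sPar σ ρ)) ∧
            ‖pinCoeff (sPar σ ρ) * pinnedG (sPar σ ρ) μ‖ < 1) ∧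
        ((σ = ρ.re / 2 ∨ σ = (1 - ρ.re) / 2) →
          ∀ μ ∈ spectrum ℂ (pinnedTransfer (sPar σ ρ)), ‖μ - 1‖ < δ σ → μ = 1)

/-! ## Registered stubs -/

/-- stub (M): the Weinstein–Aronszajn secular equation for `L_s = L̃_s − c(s)(𝟙 ⊗ δ₀)`. -/
theorem stub_weinsteinAronszajn : WeinsteinAronszajn := by
  sorry

/-- stub (L, ζ-free): continuous eigenvalue selection inside a resolvent tube (Kato). -/
theorem stub_katoSelection : KatoSelection := by
  sorry

/-- stub (RH-strength, hardest): the pinned tube along every BranchPairing segment. -/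
theorem stub_pinnedTube : PinnedTube := by
  sorry

/-! ## Proved: the lever and the bookkeeping -/

/-- `𝟙(z) = 1` on the closed disc. -/
theorem oneB_toFun {z : ℂ} (hz : z ∈ mayerClosedDisc) : oneB.toFun z = 1 :=
  MayerSpace.mk_toFun_apply _ _ _ hz

/-- The pinned operator applied: `L̃_s g = L_s g + c(s)·(g(0)·𝟙)`. -/
theorem pinnedTransfer_apply (s : ℂ) (g : MayerSpace) :
    pinnedTransfer s g = mayerTransfer s g + pinCoeff s • ((g.toFun 0) • oneB) := by
  rw [← MayerSpace.evalCLM_apply ⟨0, zero_mem_mayerClosedDisc⟩ g]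
  rfl

/-- Point values of the pinned operator: `(L̃_s g)(z) = (L_s g)(z) + c(s)·g(0)`. -/
theorem pinnedTransfer_toFun_apply (s : ℂ) (g : MayerSpace) {z : ℂ} (hz : z ∈ mayerClosedDisc) :
    (pinnedTransfer s g).toFun z = (mayerTransfer s g).toFun z + pinCoeff s * g.toFun 0 := by
  rw [pinnedTransfer_apply, MayerSpace.toFun_add, Pi.add_apply, MayerSpace.toFun_smul, Pi.smul_apply,
    MayerSpace.toFun_smul, Pi.smul_apply, oneB_toFun hz, smul_eq_mul, smul_eq_mul, mul_one]

/-- **THE LEVER (Weinstein–Aronszajn pinning).** For every `s` in the open strip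
`0 < Re s < 1/2`, the Eisenstein vector `f_s = ψ(2s, ·+1) ∈ B(D)` is a NON-ZERO eigenvector of the
pinned operator with eigenvalue exactly `1`: `L̃_s f_s = f_s`. One line from the in-tree defect
identity `mayerTransfer_zagierPsi_toFun` (`L_s f_s = f_s − ζ(2s)/2`), `zagierPsi_one`
(`f_s(0) = ζ(2s−1)`) and `riemannZeta_sub_one_ne_zero`. -/
theorem pinnedTransfer_eisenstein {s : ℂ} (hs0 : 0 < s.re) (hs1 : s.re < 1 / 2) :
    ∃ f : MayerSpace, f ≠ 0 ∧ pinnedTransfer s f = f ∧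
      ∀ z ∈ mayerClosedDisc, f.toFun z = zagierPsi (2 * s) (z + 1) := by
  have hσ0 : 0 < (2 * s).re := by simp; linarith
  have hσ1' : (2 * s).re < 1 := by simp; linarith
  have hσ : 2 * s ∈ psiDomain := ⟨hσ0, Or.inr hσ1'⟩
  set f : MayerSpace := MayerSpace.mk (fun u => zagierPsi (2 * s) (u + 1))
      (continuousOn_zagierPsi_add_one (ne_one_of_mem_psiDomain hσ).1 hσ.1)
      (differentiableOn_zagierPsi_add_one_mayerDisc (ne_one_of_mem_psiDomain hσ).1 hσ.1) with hf
  have hval : ∀ z ∈ mayerClosedDisc, f.toFun z = zagierPsi (2 * s) (z + 1) := fun z hz =>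
    MayerSpace.mk_toFun_apply _ _ _ hz
  have h0 : f.toFun 0 = riemannZeta (2 * s - 1) := by
    rw [hval 0 zero_mem_mayerClosedDisc, zero_add, zagierPsi_one hσ]
  have hζ1 : riemannZeta (2 * s - 1) ≠ 0 := riemannZeta_sub_one_ne_zero hσ0 hσ1'
  refine ⟨f, fun hf0 => ?_, MayerSpace.ext fun z hz => ?_, hval⟩
  · have h2 : f.toFun 0 = 0 := by
      rw [hf0]
      simp [MayerSpace.toFun]
    exact hζ1 (h0.symm.trans h2)
  · rw [pinnedTransfer_toFun_apply s f hz, mayerTransfer_zagierPsi_toFun hσ ⟨z, hz⟩, h0, hval z hz,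
      pinCoeff]
    field_simp
    ring

/-- `1 ∈ spec L̃_s` on the open strip (the frozen eigenvalue). -/
theorem one_mem_spectrum_pinnedTransfer {s : ℂ} (hs0 : 0 < s.re) (hs1 : s.re < 1 / 2) :
    (1 : ℂ) ∈ spectrum ℂ (pinnedTransfer s) := by
  obtain ⟨f, hf0, hf1, -⟩ := pinnedTransfer_eisenstein hs0 hs1
  exact Literature.Analysis.OperatorTheory.mem_spectrum_of_apply_eq_smul
    (by rw [hf1, one_smul]) hf0

/-- Where the pinning coefficient vanishes the pinned operator IS Mayer's operator. -/
theorem pinnedTransfer_eq_of_pinCoeff_eq_zero {s : ℂ} (h : pinCoeff s = 0) :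
    pinnedTransfer s = mayerTransfer s := by
  ext g : 1
  change mayerTransfer s g + pinCoeff s • pinK g = mayerTransfer s g
  rw [h, zero_smul, add_zero]

/-- `c(s) = 0` when `ζ(2s) = 0`. -/
theorem pinCoeff_eq_zero_of_zeta {s : ℂ} (h : riemannZeta (2 * s) = 0) : pinCoeff s = 0 := by
  simp [pinCoeff, h]

/-- `Re (σ + i Im ρ/2) = σ`. -/
lemma sPar_re (σ : ℝ) (ρ : ℂ) : (sPar σ ρ).re = σ := by simp [sPar]

/-- `Im (σ + i Im ρ/2) = Im ρ/2`. -/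
lemma sPar_im (σ : ℝ) (ρ : ℂ) : (sPar σ ρ).im = ρ.im / 2 := by simp [sPar]

/-- `σ ↦ σ + i Im ρ/2` is continuous. -/
lemma continuous_sPar (ρ : ℂ) : Continuous fun σ : ℝ => sPar σ ρ := by
  unfold sPar
  fun_prop

/-- `2·(Re ρ/2 + i Im ρ/2) = ρ`. -/
lemma two_mul_sPar_left (ρ : ℂ) : 2 * sPar (ρ.re / 2) ρ = ρ := by
  apply Complex.ext
  · simp only [sPar, Complex.mul_re, Complex.add_re, Complex.ofReal_re, Complex.ofReal_im,
      Complex.I_re, Complex.I_im, Complex.mul_im, Complex.add_im, Complex.re_ofNat,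
      Complex.im_ofNat]
    ring
  · simp only [sPar, Complex.mul_re, Complex.add_re, Complex.ofReal_re, Complex.ofReal_im,
      Complex.I_re, Complex.I_im, Complex.mul_im, Complex.add_im, Complex.re_ofNat,
      Complex.im_ofNat]
    ring

/-- `2·((1 − Re ρ)/2 + i Im ρ/2) = 1 − conj ρ`. -/
lemma two_mul_sPar_right (ρ : ℂ) : 2 * sPar ((1 - ρ.re) / 2) ρ = 1 - conj ρ := by
  apply Complex.ext
  · simp only [sPar, Complex.mul_re, Complex.add_re, Complex.ofReal_re, Complex.ofReal_im,
      Complex.I_re, Complex.I_im, Complex.mul_im, Complex.add_im, Complex.re_ofNat,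
      Complex.im_ofNat, Complex.sub_re, Complex.one_re, Complex.conj_re]
    ring
  · simp only [sPar, Complex.mul_re, Complex.add_re, Complex.ofReal_re, Complex.ofReal_im,
      Complex.I_re, Complex.I_im, Complex.mul_im, Complex.add_im, Complex.re_ofNat,
      Complex.im_ofNat, Complex.sub_im, Complex.one_im, Complex.conj_im]
    ring

/-- The reflection of a zero in the critical line is a zero: `ζ ρ = 0`, `0 < Re ρ`, `Im ρ ≠ 0`
`⇒ ζ (1 − conj ρ) = 0` (Mathlib's functional equation + conjugation symmetry). -/
lemma riemannZeta_one_sub_conj_eq_zero' {ρ : ℂ} (hζ : riemannZeta ρ = 0) (h0 : 0 < ρ.re)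
    (him : ρ.im ≠ 0) : riemannZeta (1 - conj ρ) = 0 := by
  have hconj : riemannZeta (conj ρ) = 0 := by rw [riemannZeta_conj, hζ, map_zero]
  have hn : ∀ n : ℕ, conj ρ ≠ -(n : ℂ) := by
    intro n h
    have := congrArg Complex.re h
    simp at this
    have : (0 : ℝ) ≤ n := n.cast_nonneg
    linarith
  have h1 : conj ρ ≠ 1 := by
    intro h
    have := congrArg Complex.im h
    simp at this
    exact him this
  rw [riemannZeta_one_sub hn h1, hconj, mul_zero]

/-- Parameters on the segment are admissible for Mayer's operator: `0 < Re s` and `s ≠ 1/2`. -/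
lemma sPar_ok {σ : ℝ} {ρ : ℂ} (hσ : 0 < σ) (h14 : 14 < ρ.im) :
    0 < (sPar σ ρ).re ∧ sPar σ ρ ≠ 1 / 2 := by
  refine ⟨by rw [sPar_re]; exact hσ, fun h => ?_⟩
  have := congrArg Complex.im h
  rw [sPar_im] at this
  norm_num at this
  linarith

/-- Continuity of `σ ↦ L_{σ + i Im ρ/2}` in operator norm along the segment (from the in-tree
holomorphy of Mayer's family, `MayerTransferHolomorphic_holds`). -/
lemma continuousOn_mayerTransfer_sPar {ρ : ℂ} {a b : ℝ} (ha : 0 < a) (h14 : 14 < ρ.im) :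
    ContinuousOn (fun σ : ℝ => mayerTransfer (sPar σ ρ)) (Set.Icc a b) := by
  have hc : ContinuousOn (fun s : ℂ => mayerTransfer s) {s : ℂ | 0 < s.re ∧ s ≠ 1 / 2} :=
    MayerTransferHolomorphic_holds.continuousOn
  refine ContinuousOn.comp (g := fun s : ℂ => mayerTransfer s) hc (continuous_sPar ρ).continuousOn
    fun σ hσ => ?_
  obtain ⟨h0, h1⟩ := sPar_ok (σ := σ) (ρ := ρ) (lt_of_lt_of_le ha hσ.1) h14
  exact ⟨h0, h1⟩

/-! ## The composition -/

/-- **COMPOSITION (kernel-checked, no `sorry` of its own): the three stubs imply the crux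
`MayerPairing.BranchPairing` by name.**

Proof. Pass to the operator form of the crux (`mayerPairing_branchPairing_iff_operator`, in tree).
Fix a zero `ρ` and let `δ` be the tube radius of `PinnedTube`. On the circle `|μ − 1| = δ(σ)` we
have `μ ∉ spec L̃_s` and `‖c G̃‖ < 1`, hence `1 + c G̃ ≠ 0`, hence `μ ∉ spec L_s` by
`WeinsteinAronszajn`: the tube boundary lies in the resolvent set of the norm-continuous compact
family `σ ↦ L_{σ + i Im ρ/2}` (`MayerTransferHolomorphic_holds`, `MayerTransferCompact_holds`). At the
left end `c = 0` (`ζ ρ = 0`), so `L̃ = L` and the frozen eigenvalue gives `1 ∈ spec L_{ρ/2}` (the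
lever `pinnedTransfer_eisenstein`): the tube is inhabited, and `KatoSelection` yields a continuous `Λ`
with `Λ σ ∈ spec L_s`, `|Λ σ − 1| < δ σ`. At both ends `c = 0` (functional equation at the right
end), `L̃ = L`, and the endpoint isolation of `PinnedTube` forces `Λ = 1`. Finally `|Λ σ − 1| < 1`
gives `Λ σ ≠ 0`, so `Λ σ` is an eigenvalue with a non-zero eigenvector by Mathlib's Fredholm
alternative `IsCompactOperator.hasEigenvalue_iff_mem_spectrum`. -/
theorem BranchPairing_of :
    WeinsteinAronszajn → KatoSelection → PinnedTube → BranchPairing := by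
  intro hWA hKato hTube
  rw [mayerPairing_branchPairing_iff_operator]
  intro ρ hζ h0 hhalf h14
  rcases hhalf.eq_or_lt with heq | hlt
  · -- ON-LINE zero: the segment is the point `1/4 + i Im ρ/2` and the crux is the dictionary
    -- (`exists_eigenfunction_of_riemannZeta_eq_zero`, in tree); no stub is used.
    refine ⟨fun _ => 1, continuousOn_const, rfl, rfl, fun σ hσ => ⟨one_ne_zero, ?_⟩⟩
    have hσeq : σ = ρ.re / 2 := by
      obtain ⟨h1, h2⟩ := hσ
      linarith
    have hs0 : 0 < (sPar σ ρ).re := by rw [sPar_re]; linarith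
    have hs1 : (sPar σ ρ).re < 1 / 2 := by rw [sPar_re]; linarith
    have hζ' : riemannZeta (2 * sPar σ ρ) = 0 := by rw [hσeq, two_mul_sPar_left]; exact hζ
    obtain ⟨f, hf0, hf1, -⟩ := exists_eigenfunction_of_riemannZeta_eq_zero hs0 hs1 hζ'
    exact ⟨f, hf0, by rw [one_smul]; exact hf1⟩
  -- OFF-LINE zero: the pinned tube
  obtain ⟨δ, hδc, hδ⟩ := hTube ρ hζ h0 hlt h14
  have hab : ρ.re / 2 ≤ (1 - ρ.re) / 2 := by linarith
  have ha0 : 0 < ρ.re / 2 := by linarith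
  have ha_mem : ρ.re / 2 ∈ Set.Icc (ρ.re / 2) ((1 - ρ.re) / 2) := Set.left_mem_Icc.2 hab
  have hb_mem : (1 - ρ.re) / 2 ∈ Set.Icc (ρ.re / 2) ((1 - ρ.re) / 2) := Set.right_mem_Icc.2 hab
  -- admissibility of the parameters along the segment
  have hok : ∀ σ ∈ Set.Icc (ρ.re / 2) ((1 - ρ.re) / 2), 0 < (sPar σ ρ).re ∧ sPar σ ρ ≠ 1 / 2 :=
    fun σ hσ => sPar_ok (lt_of_lt_of_le ha0 hσ.1) h14
  have hstrip : ∀ σ ∈ Set.Icc (ρ.re / 2) ((1 - ρ.re) / 2),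
      0 < (sPar σ ρ).re ∧ (sPar σ ρ).re < 1 / 2 := fun σ hσ =>
    ⟨by rw [sPar_re]; linarith [hσ.1], by rw [sPar_re]; linarith [hσ.2]⟩
  -- the family `σ ↦ L_{σ + i Im ρ/2}`: continuous, compact
  have hTc : ContinuousOn (fun σ : ℝ => mayerTransfer (sPar σ ρ)) (Set.Icc (ρ.re / 2) ((1 - ρ.re) / 2)) :=
    continuousOn_mayerTransfer_sPar ha0 h14
  have hcpt : ∀ σ ∈ Set.Icc (ρ.re / 2) ((1 - ρ.re) / 2),
      IsCompactOperator (mayerTransfer (sPar σ ρ)) := fun σ hσ =>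
    MayerTransferCompact_holds _ (hok σ hσ).1 (hok σ hσ).2
  -- Weinstein–Aronszajn: the tube boundary lies in the resolvent set of `L_s`
  have hres : ∀ σ ∈ Set.Icc (ρ.re / 2) ((1 - ρ.re) / 2), ∀ μ : ℂ, ‖μ - 1‖ = δ σ →
      μ ∉ spectrum ℂ (mayerTransfer (sPar σ ρ)) := by
    intro σ hσ μ hμ hmem
    obtain ⟨hnot, hsmall⟩ := (hδ σ hσ).2.2.1 μ hμ
    have hsec : 1 + pinCoeff (sPar σ ρ) * pinnedG (sPar σ ρ) μ = 0 := (hWA _ μ hnot).1 hmem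
    have hnorm : ‖pinCoeff (sPar σ ρ) * pinnedG (sPar σ ρ) μ‖ = 1 := by
      have h1 : pinCoeff (sPar σ ρ) * pinnedG (sPar σ ρ) μ = -1 := by linear_combination hsec
      rw [h1, norm_neg, norm_one]
    linarith
  -- `c = 0` at the two endpoints (the zero `ρ` and its reflection `1 - conj ρ`)
  have hca : pinCoeff (sPar (ρ.re / 2) ρ) = 0 := by
    apply pinCoeff_eq_zero_of_zeta
    rw [two_mul_sPar_left]
    exact hζ
  have hcb : pinCoeff (sPar ((1 - ρ.re) / 2) ρ) = 0 := by
    apply pinCoeff_eq_zero_of_zeta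
    rw [two_mul_sPar_right]
    exact riemannZeta_one_sub_conj_eq_zero' hζ h0 (by linarith)
  have hLa : pinnedTransfer (sPar (ρ.re / 2) ρ) = mayerTransfer (sPar (ρ.re / 2) ρ) :=
    pinnedTransfer_eq_of_pinCoeff_eq_zero hca
  have hLb : pinnedTransfer (sPar ((1 - ρ.re) / 2) ρ) = mayerTransfer (sPar ((1 - ρ.re) / 2) ρ) :=
    pinnedTransfer_eq_of_pinCoeff_eq_zero hcb
  -- the tube is inhabited at the left end by the FROZEN eigenvalue `1` (the lever)
  have hstart : ∃ μ ∈ spectrum ℂ (mayerTransfer (sPar (ρ.re / 2) ρ)), ‖μ - 1‖ < δ (ρ.re / 2) := by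
    refine ⟨1, ?_, ?_⟩
    · rw [← hLa]
      exact one_mem_spectrum_pinnedTransfer (hstrip _ ha_mem).1 (hstrip _ ha_mem).2
    · rw [sub_self, norm_zero]
      exact (hδ _ ha_mem).1
  -- Kato: a continuous spectral selection inside the tube
  obtain ⟨Λ, hΛc, hΛ⟩ := hKato MayerSpace (fun σ : ℝ => mayerTransfer (sPar σ ρ)) δ (ρ.re / 2)
    ((1 - ρ.re) / 2) hab hTc hδc hcpt (fun σ hσ => ⟨(hδ σ hσ).1, (hδ σ hσ).2.1⟩) hres hstart
  -- endpoint isolation forces `Λ = 1` at both ends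
  have hΛa : Λ (ρ.re / 2) = 1 := by
    refine (hδ _ ha_mem).2.2.2 (Or.inl rfl) (Λ (ρ.re / 2)) ?_ (hΛ _ ha_mem).1
    rw [hLa]
    exact (hΛ _ ha_mem).2
  have hΛb : Λ ((1 - ρ.re) / 2) = 1 := by
    refine (hδ _ hb_mem).2.2.2 (Or.inr rfl) (Λ ((1 - ρ.re) / 2)) ?_ (hΛ _ hb_mem).1
    rw [hLb]
    exact (hΛ _ hb_mem).2
  refine ⟨Λ, hΛc, hΛa, hΛb, fun σ hσ => ?_⟩
  -- `Λ σ ≠ 0` because `|Λ σ - 1| < δ σ < 1`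
  have hne : Λ σ ≠ 0 := by
    intro h0'
    have h1 := (hΛ σ hσ).1
    rw [h0', zero_sub, norm_neg, norm_one] at h1
    linarith [(hδ σ hσ).2.1]
  -- Fredholm alternative: a non-zero spectral value of the compact `L_s` is an eigenvalue
  have heig := (IsCompactOperator.hasEigenvalue_iff_mem_spectrum (hcpt σ hσ) hne).2 (hΛ σ hσ).2
  obtain ⟨v, hv⟩ := heig.exists_hasEigenvector
  refine ⟨hne, v, hv.2, ?_⟩
  have happ := hv.apply_eq_smul
  simpa [sPar] using happ

/-- **The skeleton as the crux proof-to-be**: `BranchPairing` from the three registered stubs (its only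
gaps are the `sorry`s inside `stub_weinsteinAronszajn`, `stub_katoSelection`, `stub_pinnedTube`). -/
theorem BranchPairing_proof : BranchPairing :=
  BranchPairing_of stub_weinsteinAronszajn stub_katoSelection stub_pinnedTube

end Summit.RiemannHypothesis.RiemannHypothesis.Cruxes.BranchPairing.WeinsteinAronszajnPinning

end
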